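import Mathlib
import HarnessLib
import Literature.Computability.AlgebraicComplexity.PermanentIrreducible

/-!
# ValiantsHypothesis / MonotoneRestoration — `MonotoneRestorationQP`, line `Sketch`, stub B4

Support file for crux item `stmt-ValiantsHypothesis-15886`
(`Summit.ValiantsHypothesis.ValiantsHypothesis.Theses.MonotoneRestoration.MonotoneRestorationQP`),
line `Sketch`, stub `stub_biMultilinear_blockPerm_mem_support` (Theorem β, step B4: orbit transport
for bi-multilinear supports).

If `f` over `ℝ≥0` on `Fin n × Fin n` is invariant under independent row and column permutations,
every monomial of `f` uses each row and each column at most once, and `f ≠ 0` has total degree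
`k ≤ n`, then every permutation monomial of the top-left `k × k` block (embedded along
`Fin.castLE`) lies in the support of `f`.

Proof.  A monomial `m` of top degree `k` exists (`Finset.exists_mem_eq_sup`); by the row bound it
is `0/1`-valued, so its support has exactly `k` cells, and by the row and column bounds the rows
of these cells are pairwise distinct and so are the columns.  Enumerating the cells by
`e : Fin k ≃ supp m`, the row word `t ↦ (e t).1` and the word `t ↦ Fin.castLE hkn (π t)` are both
injective, hence differ by a permutation `σ` of `Fin n` (`Equiv.extendSubtype`); likewise the
column word and `Fin.castLE hkn` differ by some `τ`.  Then
`Finsupp.mapDomain (σ × τ) m = ∑ t, e_{(castLE (π t), castLE t)}` is the embedded permutation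
monomial of `π`, and its coefficient equals that of `m` by `MvPolynomial.coeff_rename_mapDomain`
and the invariance `rename (σ × τ) f = f`.

No new definitions.
-/

-- `Summit.ValiantsHypothesis.ValiantsHypothesis.…` is the tree's mandated single-conjunct layout
-- (Sub = Summit), so the duplicated namespace component is intended.
set_option linter.dupNamespace false

noncomputable section

namespace Summit.ValiantsHypothesis.ValiantsHypothesis.Theorems

open Literature.Computability.AlgebraicComplexity MvPolynomial

/-! ### Generic helpers -/

/-- Row/column bi-invariance transports monomials of the support: if `rename (σ × τ) f = f`, then
with `m` also `Finsupp.mapDomain (σ × τ) m` is a monomial of `f`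
(`MvPolynomial.coeff_rename_mapDomain`). [folklore] -/
theorem biMultilinear_mapDomain_mem_support {n : ℕ} {R : Type*} [CommSemiring R]
    {f : MvPolynomial (Fin n × Fin n) R}
    (hsym : ∀ σ τ : Equiv.Perm (Fin n),
      MvPolynomial.rename (fun p : Fin n × Fin n => (σ p.1, τ p.2)) f = f)
    {m : Fin n × Fin n →₀ ℕ} (hm : m ∈ f.support) (σ τ : Equiv.Perm (Fin n)) :
    Finsupp.mapDomain (fun p : Fin n × Fin n => (σ p.1, τ p.2)) m ∈ f.support := by
  have hφ : Function.Injective (fun p : Fin n × Fin n => (σ p.1, τ p.2)) := by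
    intro p q h
    simp only [Prod.mk.injEq] at h
    exact Prod.ext (σ.injective h.1) (τ.injective h.2)
  have h := coeff_rename_mapDomain _ hφ f m
  rw [hsym σ τ] at h
  rw [mem_support_iff] at hm ⊢
  rwa [h]

-- adapted from `Literature.Computability.AlgebraicComplexity.exists_perm_apply_eq`
-- (ReadKDeterminantalRepresentationsProofs.lean), restated for a `Finite` target to avoid the import.
/-- Two injections from the same type into a finite type differ by a permutation of the target
(`Equiv.extendSubtype` of the bijection between the two ranges). [folklore] -/
theorem biMultilinear_exists_perm_apply_eq {α β : Type*} [Finite β] (a c : α → β)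
    (ha : Function.Injective a) (hc : Function.Injective c) :
    ∃ σ : Equiv.Perm β, ∀ t, σ (a t) = c t := by
  classical
  let e : {b // b ∈ Set.range a} ≃ {b // b ∈ Set.range c} :=
    (Equiv.ofInjective a ha).symm.trans (Equiv.ofInjective c hc)
  refine ⟨e.extendSubtype, fun t => ?_⟩
  rw [Equiv.extendSubtype_apply_of_mem e (a t) ⟨t, rfl⟩]
  simp only [e, Equiv.trans_apply]
  rw [Equiv.ofInjective_symm_apply, Equiv.ofInjective_apply]

/-- A non-zero polynomial has a monomial of top degree. [folklore] -/
theorem exists_mem_support_sum_eq_totalDegree {ι R : Type*} [CommSemiring R]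
    {f : MvPolynomial ι R} (hf : f ≠ 0) :
    ∃ m ∈ f.support, (m.sum fun _ e => e) = f.totalDegree := by
  obtain ⟨m, hm, h⟩ := f.support.exists_mem_eq_sup (support_nonempty.2 hf)
    (fun s : ι →₀ ℕ => s.sum fun _ e => e)
  exact ⟨m, hm, by rw [MvPolynomial.totalDegree, h]⟩

/-! ### `0/1`-structure of bi-multilinear exponent vectors -/

/-- Each entry of an exponent vector is bounded by its row count. [folklore] -/
theorem apply_le_rowCount {ι : Type*} [Fintype ι] (m : ι × ι →₀ ℕ) (r c : ι) :
    m (r, c) ≤ rowCount m r :=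
  Finset.single_le_sum_of_canonicallyOrdered (f := fun x => m (r, x)) (Finset.mem_univ c)

/-- If every row count is `≤ 1`, two cells of the support in the same row coincide. [folklore] -/
theorem eq_of_fst_eq_of_rowCount_le_one {ι : Type*} [Fintype ι] [DecidableEq ι]
    {m : ι × ι →₀ ℕ} (hrow : ∀ i, rowCount m i ≤ 1) {p q : ι × ι} (hp : p ∈ m.support)
    (hq : q ∈ m.support) (h : p.1 = q.1) : p = q := by
  obtain ⟨r, c⟩ := p
  obtain ⟨r', c'⟩ := q
  dsimp only at h
  subst h
  by_contra hne
  have hc : c ≠ c' := fun hcc => hne (by rw [hcc])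
  rw [Finsupp.mem_support_iff] at hp hq
  have hsum : ∑ x ∈ {c, c'}, m (r, x) ≤ ∑ x, m (r, x) :=
    Finset.sum_le_sum_of_subset (Finset.subset_univ _)
  rw [Finset.sum_pair hc] at hsum
  have h1 := hrow r
  unfold rowCount at h1
  omega

/-- If every column count is `≤ 1`, two cells of the support in the same column coincide.
[folklore] -/
theorem eq_of_snd_eq_of_colCount_le_one {ι : Type*} [Fintype ι] [DecidableEq ι]
    {m : ι × ι →₀ ℕ} (hcol : ∀ j, colCount m j ≤ 1) {p q : ι × ι} (hp : p ∈ m.support)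
    (hq : q ∈ m.support) (h : p.2 = q.2) : p = q := by
  obtain ⟨r, c⟩ := p
  obtain ⟨r', c'⟩ := q
  dsimp only at h
  subst h
  by_contra hne
  have hr : r ≠ r' := fun hrr => hne (by rw [hrr])
  rw [Finsupp.mem_support_iff] at hp hq
  have hsum : ∑ x ∈ {r, r'}, m (x, c) ≤ ∑ x, m (x, c) :=
    Finset.sum_le_sum_of_subset (Finset.subset_univ _)
  rw [Finset.sum_pair hr] at hsum
  have h1 := hcol c
  unfold colCount at h1
  omega

/-- A `0/1`-valued exponent vector has degree equal to the size of its support. [folklore] -/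
theorem sum_eq_card_support_of_apply_eq_one {α : Type*} {m : α →₀ ℕ}
    (h1 : ∀ p ∈ m.support, m p = 1) : (m.sum fun _ e => e) = m.support.card := by
  rw [Finset.card_eq_sum_ones, Finsupp.sum]
  exact Finset.sum_congr rfl h1

/-- A `0/1`-valued exponent vector is the sum of the unit vectors of its support. [folklore] -/
theorem eq_sum_single_of_apply_eq_one {α : Type*} {m : α →₀ ℕ}
    (h1 : ∀ p ∈ m.support, m p = 1) : m = ∑ p ∈ m.support, Finsupp.single p 1 := by
  conv_lhs => rw [← Finsupp.sum_single m]
  rw [Finsupp.sum]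
  exact Finset.sum_congr rfl fun p hp => by rw [h1 p hp]

/-! ### The stub -/

/-- **B4 — orbit transport for bi-multilinear supports.** If `f` over `ℝ≥0` on `Fin n × Fin n` is
invariant under independent row and column permutations, every monomial of `f` uses each row and
each column at most once, and `f ≠ 0` has total degree `k`, then EVERY permutation monomial of the
top-left `k × k` block (embedded along `Fin.castLE`) is a monomial of `f`: a top-degree monomial
is a partial permutation between `k` rows and `k` columns, moved onto the embedded permutation
monomial of `π` by a suitable `(σ, τ)` (`MvPolynomial.coeff_rename_mapDomain`). [folklore] -/
theorem stub_biMultilinear_blockPerm_mem_support {n : ℕ} (f : MvPolynomial (Fin n × Fin n) NNReal)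
    (hsym : ∀ σ τ : Equiv.Perm (Fin n),
      MvPolynomial.rename (fun p : Fin n × Fin n => (σ p.1, τ p.2)) f = f)
    (hbi : ∀ m ∈ f.support, (∀ i, rowCount m i ≤ 1) ∧ (∀ j, colCount m j ≤ 1))
    (hf : f ≠ 0) {k : ℕ} (hk : f.totalDegree = k) (hkn : k ≤ n) (π : Equiv.Perm (Fin k)) :
    Finsupp.mapDomain (fun p : Fin k × Fin k => (Fin.castLE hkn p.1, Fin.castLE hkn p.2))
      (permMonomial π) ∈ f.support := by
  -- (i) a monomial of top degree `k`
  obtain ⟨m, hm, hmdeg⟩ := exists_mem_support_sum_eq_totalDegree hf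
  rw [hk] at hmdeg
  obtain ⟨hrow, hcol⟩ := hbi m hm
  -- (ii) it is `0/1`-valued with exactly `k` cells
  have h1 : ∀ p ∈ m.support, m p = 1 := fun p hp => by
    have hle : m (p.1, p.2) ≤ 1 := (apply_le_rowCount m p.1 p.2).trans (hrow p.1)
    have hne : m p ≠ 0 := Finsupp.mem_support_iff.1 hp
    simp only [Prod.mk.eta] at hle
    omega
  have hcard : m.support.card = k := by
    rw [← hmdeg, sum_eq_card_support_of_apply_eq_one h1]
  -- (iii) enumerate the cells; rows and columns are injective words
  obtain ⟨e⟩ : Nonempty (Fin k ≃ {p // p ∈ m.support}) := ⟨(Finset.equivFinOfCardEq hcard).symm⟩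
  have ha : Function.Injective (fun t : Fin k => (e t : Fin n × Fin n).1) := by
    intro t t' h
    exact e.injective (Subtype.ext (eq_of_fst_eq_of_rowCount_le_one hrow (e t).2 (e t').2 h))
  have hb : Function.Injective (fun t : Fin k => (e t : Fin n × Fin n).2) := by
    intro t t' h
    exact e.injective (Subtype.ext (eq_of_snd_eq_of_colCount_le_one hcol (e t).2 (e t').2 h))
  have hι : Function.Injective (Fin.castLE hkn) := Fin.castLE_injective hkn
  obtain ⟨σ, hσ⟩ : ∃ σ : Equiv.Perm (Fin n), ∀ t, σ (e t : Fin n × Fin n).1 =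
      Fin.castLE hkn (π t) :=
    biMultilinear_exists_perm_apply_eq _ _ ha (hι.comp π.injective)
  obtain ⟨τ, hτ⟩ : ∃ τ : Equiv.Perm (Fin n), ∀ t, τ (e t : Fin n × Fin n).2 = Fin.castLE hkn t :=
    biMultilinear_exists_perm_apply_eq _ _ hb hι
  -- (iv) `(σ × τ) · m` is the embedded permutation monomial of `π`
  have hm_eq : (∑ t : Fin k, Finsupp.single (e t : Fin n × Fin n) (1 : ℕ)) = m := by
    rw [Equiv.sum_comp e (fun p : {p // p ∈ m.support} => Finsupp.single (p : Fin n × Fin n) 1),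
      Finset.sum_coe_sort m.support (fun p => Finsupp.single p 1)]
    exact (eq_sum_single_of_apply_eq_one h1).symm
  have key : Finsupp.mapDomain (fun p : Fin n × Fin n => (σ p.1, τ p.2)) m =
      Finsupp.mapDomain (fun p : Fin k × Fin k => (Fin.castLE hkn p.1, Fin.castLE hkn p.2))
        (permMonomial π) := by
    rw [← hm_eq, Finsupp.mapDomain_finsetSum, permMonomial, Finsupp.mapDomain_finsetSum]
    simp only [Finsupp.mapDomain_single]
    refine Finset.sum_congr rfl fun t _ => ?_
    rw [hσ t, hτ t]
  rw [← key]
  exact biMultilinear_mapDomain_mem_support hsym hm σ τ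

end Summit.ValiantsHypothesis.ValiantsHypothesis.Theorems
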